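import Literature.MathematicalPhysics.QuantumFieldTheory.Balaban1983to89.Node00.HessianOperatorAtBackground

/-!
# BalabanUVNodes ∕ N07 — [Balaban1985Variational] Sect. B (26) ∕ [Balaban1985BackgroundPropagators] (3.10) AT THE TRIVIAL BACKGROUND, IN THE LETTERS OF THE
# LINEAR CALCULUS OF RECORD: the Hessian operator `Δ_1` of the action of record (`Node00.hessOpAt η 1`, audit D2) has the quadratic form
# `⟪X, Δ_1 X⟫ = N⁻¹ Σ_{x, μ<ν} Re tr((δ_μX_ν − δ_νX_μ)(x)* (δ_μX_ν − δ_νX_μ)(x))` with `δ_μ = LatticeFieldCalculus.pdiff 1 μ` ([Balaban1984PropagatorsI] (1.2)) —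
# «the operator ∂*∂ in the Abelian case» ([5] p. 392) — the junction the flat (UST ∕ [B5]–[B6]) operator theorems are written against

Track A node N07, cell `pub-ymgap` (D-0062 ∕ D-0149); width seat `pub-ymgap-dag-n07-w1` (g0), S1 follow-up (c) «flat junction» (dag-lead g14 DEDUP-363: no objection).  NEW leaf;
CONSUMED BY NAME: `Node00/HessianOperatorAtBackground` (`hessFormAt_one_self`, `inner_hessOpAt`), pv27 `B9Eq39Adjoint.curl ∕ covD`, `B9TorusCalculus.covD_one_eq_pdiff`,
`LatticeFieldCalculus.pdiff`.  `--kind proof --supports stmt-QuantumFields-20542 --as helper` (K1⁷; count-neutral).  THEOREMS ONLY.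
* `curl_torusT_one_eq_pdiff` — pv27's curl (3.4) at `U ≡ 1` on `T^{(j)}` IS the antisymmetrised forward difference `δ_μX_ν − δ_νX_μ` of the linear calculus of record.
* ★ `hessFormAt_one_self_pdiff`, ★ `inner_hessOpAt_one_self_pdiff` — the flat Hessian form ∕ operator of record in those letters (`η` drops out).
HONEST FRAMING: exact finite algebra at the objects of record; no estimate; nothing of Bałaban asserted; N07 NOT discharged; K1⁷ NOT closed; counts unmoved (28∕28 · 5∕27);
one finite 𝕋⁴ programme at fixed ε — NOT continuum ∕ ℝ⁴ ∕ OS ∕ mass gap ∕ Clay.  0 def, 0 sorry.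
-/

noncomputable section

namespace Summit.QuantumFields.YangMills.BalabanUVNodes.N07SectBFlatHessian

open Literature.MathematicalPhysics.QuantumFieldTheory.Balaban1983to89
open Literature.MathematicalPhysics.QuantumFieldTheory.Balaban1983to89.Node00
open B9TorusCalculus (torusT)
open T4AdjointCovarianceUnitary (lieSU)
open scoped InnerProductSpace

variable {N : ℕ} {P : Params} {j : ℕ}

/-- **pv27's curl at the trivial background IS the antisymmetrised forward difference of the linear calculus of record**:
`curl (torusT P j) 1 X (μ, ν, x) = (δ_μ X_ν)(x) − (δ_ν X_μ)(x)`, `δ_μ = LatticeFieldCalculus.pdiff 1 μ` (`B9TorusCalculus.covD_one_eq_pdiff` twice).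
[cite: Balaban1985BackgroundPropagators, (3.4) p.391; Balaban1984PropagatorsI, (1.2) p.19] -/
theorem curl_torusT_one_eq_pdiff (X : Fin P.d → Site P j → Matrix (Fin N) (Fin N) ℂ) (μ ν : Fin P.d) (x : Site P j) :
    B9Eq39Adjoint.curl (torusT P j) (fun _ _ => (1 : (Matrix (Fin N) (Fin N) ℂ)ˣ)) X μ ν x =
      LatticeFieldCalculus.pdiff 1 μ (X ν) x - LatticeFieldCalculus.pdiff 1 ν (X μ) x := by
  rw [B9Eq39Adjoint.curl, B9TorusCalculus.covD_one_eq_pdiff, B9TorusCalculus.covD_one_eq_pdiff]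

variable [NeZero N]

/-- ★ **THE FLAT HESSIAN FORM OF RECORD IN THE LETTERS OF THE LINEAR CALCULUS**: `𝔥_1(X, X) = N⁻¹ Σ_{(x, μ<ν)} Re tr(F_{μν}(x)* F_{μν}(x))`,
`F_{μν} = δ_μ X_ν − δ_ν X_μ` (`Node00.hessFormAt_one_self` + `curl_torusT_one_eq_pdiff`). [cite: Balaban1985BackgroundPropagators, (3.10) p.392; Balaban1984PropagatorsI, (1.2) p.19] -/
theorem hessFormAt_one_self_pdiff {η : ℝ} (hη : η ≠ 0) (X : TangentBondSU P j N) :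
    hessFormAt η (1 : GaugeField P j (SU N)) X X =
      (N : ℝ)⁻¹ * ∑ q ∈ B9Eq39Adjoint.posPlaq (Site P j) (Fin P.d),
        (Matrix.conjTranspose
            (LatticeFieldCalculus.pdiff 1 q.2.1 (fun y => ((X ⟨y, q.2.2⟩ : lieSU (Fin N)) : Matrix (Fin N) (Fin N) ℂ)) q.1 -
              LatticeFieldCalculus.pdiff 1 q.2.2 (fun y => ((X ⟨y, q.2.1⟩ : lieSU (Fin N)) : Matrix (Fin N) (Fin N) ℂ)) q.1) *
          (LatticeFieldCalculus.pdiff 1 q.2.1 (fun y => ((X ⟨y, q.2.2⟩ : lieSU (Fin N)) : Matrix (Fin N) (Fin N) ℂ)) q.1 -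
            LatticeFieldCalculus.pdiff 1 q.2.2 (fun y => ((X ⟨y, q.2.1⟩ : lieSU (Fin N)) : Matrix (Fin N) (Fin N) ℂ)) q.1)).trace.re := by
  rw [hessFormAt_one_self hη]
  congr 1
  refine Finset.sum_congr rfl fun q _ => ?_
  rw [curl_torusT_one_eq_pdiff]

/-- ★ **… and for the OPERATOR**: `⟪X, Δ_1 X⟫ = N⁻¹ Σ_{(x, μ<ν)} Re tr(F_{μν}(x)* F_{μν}(x))` — the junction the flat operator theorems ([B5]–[B6] ∕ UST) are written against.
[cite: Balaban1985BackgroundPropagators, (3.10) p.392; Balaban1984PropagatorsI, (1.2) p.19] -/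
theorem inner_hessOpAt_one_self_pdiff {η : ℝ} (hη : η ≠ 0) (X : TangentBondSU P j N) :
    ⟪X, hessOpAt η (1 : GaugeField P j (SU N)) X⟫_ℝ =
      (N : ℝ)⁻¹ * ∑ q ∈ B9Eq39Adjoint.posPlaq (Site P j) (Fin P.d),
        (Matrix.conjTranspose
            (LatticeFieldCalculus.pdiff 1 q.2.1 (fun y => ((X ⟨y, q.2.2⟩ : lieSU (Fin N)) : Matrix (Fin N) (Fin N) ℂ)) q.1 -
              LatticeFieldCalculus.pdiff 1 q.2.2 (fun y => ((X ⟨y, q.2.1⟩ : lieSU (Fin N)) : Matrix (Fin N) (Fin N) ℂ)) q.1) *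
          (LatticeFieldCalculus.pdiff 1 q.2.1 (fun y => ((X ⟨y, q.2.2⟩ : lieSU (Fin N)) : Matrix (Fin N) (Fin N) ℂ)) q.1 -
            LatticeFieldCalculus.pdiff 1 q.2.2 (fun y => ((X ⟨y, q.2.1⟩ : lieSU (Fin N)) : Matrix (Fin N) (Fin N) ℂ)) q.1)).trace.re := by
  rw [inner_hessOpAt, hessFormAt_one_self_pdiff hη]

end Summit.QuantumFields.YangMills.BalabanUVNodes.N07SectBFlatHessian

end
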